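import Summits.Parity.GeneralizedHardyLittlewood.Theorems.BeyondDiagonalBeatsQuarter.OffDiagDualCostProfile
import Literature.Analysis.Calculus.WhitneyConvexPartition
import HarnessLib

/-!
# Route `PrimeLevelFamEdge`, crux K_B (stmt-Parity-20343), line `diagonal_kernel_split` rev 4, plan Ω,
# lemma L2c (derivative costs), step 5: **the `y₁`-slices of a box weight — `k` derivatives cost `((1+Z)/K₁)ᵏ`**

A `y₁`-slice of d5's box weight `Φ_i(y₁,y₂) = θ(y₁/K₁)θ(y₂/K₂)·g(y₁,y₂)` at fixed `y₂ > 0` is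
`y₁ ↦ θ(y₁/K₁) · θ₂ · G(y₁)`, `θ₂ = θ(y₂/K₂)`, where — because the layer weight depends on `(y₁,y₂)` through
`t = y₁y₂` only — `G` is again a PROFILE of step 4, `G(s) = C·s^{−1/2}·W(as)·J₁(b√s)` with the `y₂`-dependent
constants `C = (d₁d₂y₂)^{−1/2}r⁻¹`, `a = d₁d₂y₂/q̂²`, `b = 4π√(αβy₂)/(qr)` (so that `b√y₁ = Z`). This file bounds all
`y₁`-derivatives of such a slice on the box `0 < y₁ ≤ 2K₁`:

* `iteratedDeriv_dyadicBump_div`, `abs_pow_mul_iteratedDeriv_dyadicBump_div_le` — `|y ⁱ(dⁱ/dyⁱ)θ(y/K)| ≤ 2ⁱ·Θᵢ`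
  for `0 ≤ y ≤ 2K` (`Θᵢ = WhitneyConvex.dyadicBumpBound i`);
* **`abs_pow_mul_iteratedDeriv_boxSlice_le`** — for `0 < y ≤ 2K`, `a > 0`:
  `|yᵏ (dᵏ/dyᵏ)[θ(y/K)·θ₂·C y^{−1/2} W(ay) J_n(b√y)]| ≤ 𝓒_k · (1+|b|√y)ᵏ · |θ₂|·|C|·y^{−1/2}`,
  `𝓒_k = Σ_{i≤k} binom(k,i) 2ⁱΘᵢ ((k−i)+1)²(k−i)!(k−i)^{k−i}` (depends on `k` only); dividing by `yᵏ ≥ (K/2)ᵏ` on the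
  box `[K/2, 2K]` gives the cost `(2(1+Z)/K)ᵏ` per OMEGA-BLUEPRINT §2.

What remains for L2c after this file: the pointwise identification `layerWeightR q d₁ d₂ α β r (y₁,y₂) = θ₂⁻¹·(slice)`
on the open quadrant, the box integrals `A_k, B_k` (with `∂₂²` first for `B_k`), and the plug-in into
`tsum_tail_norm_fourier2_mul_le_of_cost`. Folklore real analysis, PROVED; theorems only. Helper; closes nothing.
«The programme SEARCHES and TYPES; no claim about Landau–Siegel zeros, Theorems 1–2 of arXiv:2211.02515 or
a repaired Margin232 until a kernel theorem says so.»
-/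

noncomputable section

open Real Set Finset
open scoped Topology ContDiff Nat

namespace Summit.Parity.GeneralizedHardyLittlewood.Theorems.BeyondDiagonalBeatsQuarter.OffDiagPoissonTwisted

open Literature.Analysis.FunctionSpaces Literature.NumberTheory.LFunctions.KMV2000
open Literature.Analysis.Calculus.WhitneyConvex (dyadicBump contDiff_dyadicBump dyadicBumpBound
  dyadicBumpBound_nonneg norm_iteratedFDeriv_dyadicBump_le)

/-! ### The scaled bump `y ↦ θ(y/K)` -/

/-- `θ` is `C^n` for every natural `n` (exponent bookkeeping). [folklore] -/
theorem contDiff_dyadicBump_nat (n : ℕ) : ContDiff ℝ n dyadicBump :=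
  (contDiff_dyadicBump (n := ⊤)).of_le (by exact_mod_cast le_top)

/-- `(dⁱ/dyⁱ) θ(y/K) = K^{−i} θ^{(i)}(y/K)`. [folklore] -/
theorem iteratedDeriv_dyadicBump_div (K : ℝ) (i : ℕ) (y : ℝ) :
    iteratedDeriv i (fun s : ℝ => dyadicBump (s / K)) y = (K⁻¹) ^ i * iteratedDeriv i dyadicBump (y / K) := by
  have hfun : (fun s : ℝ => dyadicBump (s / K)) = fun s : ℝ => dyadicBump (K⁻¹ * s) := by
    funext s; rw [div_eq_inv_mul]
  rw [hfun, iteratedDeriv_comp_const_mul (contDiff_dyadicBump_nat i) K⁻¹]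
  dsimp only
  rw [div_eq_inv_mul]

/-- **On the box**: `|yⁱ (dⁱ/dyⁱ)θ(y/K)| ≤ 2ⁱ·Θᵢ` for `0 ≤ y ≤ 2K` (`Θᵢ = dyadicBumpBound i`). [folklore] -/
theorem abs_pow_mul_iteratedDeriv_dyadicBump_div_le {K : ℝ} (hK : 0 < K) (i : ℕ) {y : ℝ} (hy0 : 0 ≤ y)
    (hy : y ≤ 2 * K) :
    |y ^ i * iteratedDeriv i (fun s : ℝ => dyadicBump (s / K)) y| ≤ 2 ^ i * dyadicBumpBound i := by
  rw [iteratedDeriv_dyadicBump_div K, ← mul_assoc, ← mul_pow, abs_mul, abs_pow]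
  have h1 : |y * K⁻¹| ≤ 2 := by
    rw [abs_of_nonneg (by positivity), mul_inv_le_iff₀ hK]
    linarith
  have h2 : |iteratedDeriv i dyadicBump (y / K)| ≤ dyadicBumpBound i := by
    rw [← Real.norm_eq_abs, ← norm_iteratedFDeriv_eq_norm_iteratedDeriv]
    exact norm_iteratedFDeriv_dyadicBump_le i _
  exact mul_le_mul (pow_le_pow_left₀ (abs_nonneg _) h1 i) h2 (abs_nonneg _) (by positivity)

/-! ### The slice `θ(y/K) · θ₂ · G(y)` -/

/-- The profile of step 4 is `C^n` at every `y > 0`. [folklore] -/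
theorem contDiffAt_profile (C : ℝ) {a : ℝ} (ha : 0 < a) (nB : ℕ) (b : ℝ) {y : ℝ} (hy : 0 < y) (n : ℕ) :
    ContDiffAt ℝ n (fun s : ℝ => C * s ^ (-(1 : ℝ) / 2) * (cutoffW (a * s) * besselJ nB (b * Real.sqrt s))) y :=
  (contDiffAt_const.mul (contDiffAt_rpow_const_of_ne hy.ne')).mul
    ((contDiffAt_cutoffW_comp_mul ha hy n).mul (contDiffAt_besselJ_sqrt nB b hy n))

/-- **All `y₁`-derivatives of a box-weight slice.** For `K > 0`, `0 < y ≤ 2K`, `a > 0` and constants `θ₂, C, b`: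
`|yᵏ (dᵏ/dyᵏ)[θ(y/K)·(θ₂·(C y^{−1/2}·(W(ay)·J_n(b√y))))]| ≤ 𝓒_k · (1+|b|√y)ᵏ · (|θ₂|·(|C|·y^{−1/2}))`,
`𝓒_k = Σ_{i≤k} binom(k,i)·2ⁱΘᵢ·((k−i)+1)²(k−i)!(k−i)^{k−i}`. [folklore] -/
theorem abs_pow_mul_iteratedDeriv_boxSlice_le {K : ℝ} (hK : 0 < K) (θ₂ C : ℝ) {a : ℝ} (ha : 0 < a) (nB : ℕ)
    (b : ℝ) (k : ℕ) {y : ℝ} (hy0 : 0 < y) (hy : y ≤ 2 * K) :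
    |y ^ k * iteratedDeriv k (fun s : ℝ => dyadicBump (s / K) *
        (θ₂ * (C * s ^ (-(1 : ℝ) / 2) * (cutoffW (a * s) * besselJ nB (b * Real.sqrt s))))) y| ≤
      (∑ i ∈ Finset.range (k + 1), (k.choose i : ℝ) * (2 ^ i * dyadicBumpBound i) *
          ((((k - i : ℕ) : ℝ) + 1) ^ 2 * (k - i) ! * ((k - i : ℕ) : ℝ) ^ (k - i))) *
        (1 + |b| * Real.sqrt y) ^ k * (|θ₂| * (|C| * y ^ (-(1 : ℝ) / 2))) := by
  set Z : ℝ := 1 + |b| * Real.sqrt y with hZ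
  have hZ1 : 1 ≤ Z := by rw [hZ]; linarith [mul_nonneg (abs_nonneg b) (Real.sqrt_nonneg y)]
  set S : ℝ := |C| * y ^ (-(1 : ℝ) / 2) with hS
  have hS0 : 0 ≤ S := mul_nonneg (abs_nonneg C) (Real.rpow_pos_of_pos hy0 _).le
  have hf : ContDiffAt ℝ k (fun s : ℝ => dyadicBump (s / K)) y :=
    ((contDiff_dyadicBump_nat k).comp (contDiff_id.div_const K)).contDiffAt
  have hg : ContDiffAt ℝ k (fun s : ℝ =>
      θ₂ * (C * s ^ (-(1 : ℝ) / 2) * (cutoffW (a * s) * besselJ nB (b * Real.sqrt s)))) y :=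
    contDiffAt_const.mul (contDiffAt_profile C ha nB b hy0 k)
  -- the `g`-bounds: constant `θ₂` times the profile bound of step 4
  have hB : ∀ j, j ≤ k → |y ^ j * iteratedDeriv j (fun s : ℝ =>
      θ₂ * (C * s ^ (-(1 : ℝ) / 2) * (cutoffW (a * s) * besselJ nB (b * Real.sqrt s)))) y| ≤
        |θ₂| * ((((j : ℕ) : ℝ) + 1) ^ 2 * j ! * (j : ℝ) ^ j * Z ^ j * S) := by
    intro j _
    rw [iteratedDeriv_const_mul θ₂ (contDiffAt_profile C ha nB b hy0 j)]
    rw [show y ^ j * (θ₂ * iteratedDeriv j (fun s : ℝ =>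
        C * s ^ (-(1 : ℝ) / 2) * (cutoffW (a * s) * besselJ nB (b * Real.sqrt s))) y) =
        θ₂ * (y ^ j * iteratedDeriv j (fun s : ℝ =>
          C * s ^ (-(1 : ℝ) / 2) * (cutoffW (a * s) * besselJ nB (b * Real.sqrt s))) y) by ring, abs_mul]
    exact mul_le_mul_of_nonneg_left (abs_pow_mul_iteratedDeriv_profile_le C ha nB b j hy0) (abs_nonneg _)
  have hmain := abs_pow_mul_iteratedDeriv_mul_le hf hg (A := fun i => 2 ^ i * dyadicBumpBound i)
    (B := fun j => |θ₂| * ((((j : ℕ) : ℝ) + 1) ^ 2 * j ! * (j : ℝ) ^ j * Z ^ j * S))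
    (fun i _ => abs_pow_mul_iteratedDeriv_dyadicBump_div_le hK i hy0.le hy) hB
  refine hmain.trans ?_
  -- `Z^{k-i} ≤ Z^k`, then factor
  have hterm : ∀ i ∈ Finset.range (k + 1),
      (k.choose i : ℝ) * (2 ^ i * dyadicBumpBound i) *
          (|θ₂| * ((((k - i : ℕ) : ℝ) + 1) ^ 2 * (k - i) ! * ((k - i : ℕ) : ℝ) ^ (k - i) * Z ^ (k - i) * S)) ≤
        (k.choose i : ℝ) * (2 ^ i * dyadicBumpBound i) *
          ((((k - i : ℕ) : ℝ) + 1) ^ 2 * (k - i) ! * ((k - i : ℕ) : ℝ) ^ (k - i)) * (Z ^ k * (|θ₂| * S)) := by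
    intro i _
    have hZi : Z ^ (k - i) ≤ Z ^ k := pow_le_pow_right₀ hZ1 (Nat.sub_le k i)
    have hc0 : 0 ≤ (k.choose i : ℝ) * (2 ^ i * dyadicBumpBound i) *
        ((((k - i : ℕ) : ℝ) + 1) ^ 2 * (k - i) ! * ((k - i : ℕ) : ℝ) ^ (k - i)) * (|θ₂| * S) := by
      have := dyadicBumpBound_nonneg i
      positivity
    calc (k.choose i : ℝ) * (2 ^ i * dyadicBumpBound i) *
          (|θ₂| * ((((k - i : ℕ) : ℝ) + 1) ^ 2 * (k - i) ! * ((k - i : ℕ) : ℝ) ^ (k - i) * Z ^ (k - i) * S))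
        = (k.choose i : ℝ) * (2 ^ i * dyadicBumpBound i) *
            ((((k - i : ℕ) : ℝ) + 1) ^ 2 * (k - i) ! * ((k - i : ℕ) : ℝ) ^ (k - i)) * (|θ₂| * S) *
              Z ^ (k - i) := by ring
      _ ≤ (k.choose i : ℝ) * (2 ^ i * dyadicBumpBound i) *
            ((((k - i : ℕ) : ℝ) + 1) ^ 2 * (k - i) ! * ((k - i : ℕ) : ℝ) ^ (k - i)) * (|θ₂| * S) *
              Z ^ k := mul_le_mul_of_nonneg_left hZi hc0
      _ = _ := by ring
  refine (Finset.sum_le_sum hterm).trans (le_of_eq ?_)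
  rw [← Finset.sum_mul]
  ring

end Summit.Parity.GeneralizedHardyLittlewood.Theorems.BeyondDiagonalBeatsQuarter.OffDiagPoissonTwisted
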